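import Summits.QuantumFields.BalabanUV.Beta.RemainderCouplingHolomorphy
import Literature.MathematicalPhysics.QuantumFieldTheory.Balaban1983to89.B12CauchyRemainder354

/-!
# RemainderCouplingHolomorphyAllOrders — (D4-J7) R-266 ⇒ THE p. 264 CLAUSE IN FULL: uniform (ρ, M) coupling-holomorphy
# gives, for EVERY order m, |∂^m β_{k+1}∕∂g_k^m| ≤ m!·M∕ρ^m on [0, γ₀], uniformly in the scale and the history (Cauchy's
# estimates of all orders), i.e. [I] p. 264 tl.25–27 «smooth … uniformly bounded on this interval together with all
# derivatives» READ UNIFORM IN j, with explicit constants; its m = 1 line is R-264's `LastVarDerivBound β (M∕ρ) γ₀` with the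
# SHARP radius ((D4-J5) had M∕ρ′, ρ′ < ρ); conversely the full clause's first-order line alone already enters R-264's chain

Cell `pub-balaban`, β-function sub-cell, BINDER row D4 «RemainderConst leaves for Bałaban's split» (`HOME/BINDER-OWNERS.md`; this
file by the row OWNER lineage `b2b-balaban-beta-an4`, generation 62), β-FLOW TEAM duty (1); FREEZE (0) honoured (def-free module in
the lineage's own `Beta/…Remainder…` series; no leaf, no interface, no Literature file).  OCCASION: (D4-J5)
`RemainderCouplingHolomorphy` (gen 61, p292106) typed print's «(or analytic)» alternative ([I] p. 263 tl.25–26, p. 264 tl.25–27,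
mechanism p. 266 tl.33–37) as the route R-266 and read out ONLY its first-order consequence; the co-owners' (E16)
`EriceRemainderEnclosureHolomorphyNecessity` (d4-p2 g22) shows the uniform pair (ρ, M) is load-bearing, each half.  Print's clause
itself speaks of ALL derivatives.  This file closes the bookkeeping triangle between print's two wordings of the regularity of
β_j in the running coupling: «analytic» with ONE (ρ, M) ⟹ «all derivatives uniformly bounded» with the explicit Cauchy constants
m!·M∕ρ^m ⟹ (first-order line) R-264 ⟹ (AF-1) ⟹ the JUNCTION shape of (D4).

HONEST FRAMING (BETA-SPEC §0.2, verbatim and binding). *"Discharging BetaPertH makes Bałaban's UV stability UNCONDITIONAL — a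
real constructive-QFT result; it is NOT the continuum limit and NOT the Clay problem."*  THIS MODULE DISCHARGES NOTHING: it is
Cauchy's inequality of order m (tree `B12CauchyRemainder354.norm_iteratedDeriv_le_of_ball`, Mathlib
`Complex.norm_iteratedDeriv_le_of_forall_mem_sphere_norm_le`) and the real-restriction calculus
(`B12CauchyRemainder354.iteratedDeriv_comp_ofReal`, `ContinuousLinearMap.iteratedFDeriv_comp_left` for `re`) applied to the tree's
typed shapes `FlowStep.HBeta`, `B12Beta.OneLoopSplit`, `BetaDerivClause.LastVarDerivBound`, `Beta.RemainderChain.RemainderConst`;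
the holomorphic extension is a HYPOTHESIS (nothing of Bałaban's (1.22) is asserted, constructed or instantiated); row D4 class
UNCHANGED (critical-path width 0; instance 0∕1; D4 DISCHARGE NO DATE).  NOT BetaPertH, NOT continuum, NOT Clay.  HONEST DEPENDENCY:
continuum YM on T⁴ ⇐ BetaPertH ∧ nine spine estimates (0/9 proved); BetaPertH ⇐ (D1) ∧ (D4) ∧ CAP+tail; G-an2-4 gates asym, D1 and
NE2/3/4.

WHAT IS PROVED ([folklore]; 0 sorry; 0 `def`).  The hypothesis is (D4-J5)'s, verbatim: for every scale k and history p ∈ ]0,γ₀]^{k+1}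
an `F : ℂ → ℂ` complex-differentiable on the open ρ-neighbourhood `{z | ∃ s ∈ [0, γ₀], dist z s < ρ}` of the segment, ‖F‖ ≤ M
there, F(g) = β_{k+1}(g₀,…,g_{k−1}, g) for g ∈ [0, γ₀] — ONE ρ, ONE M.
* §0 the neighbourhood: `isOpen_nhd`, `ball_subset_nhd` (the disc of radius ρ about a point of the segment lies inside — so the
  Cauchy radius is ρ itself, not ρ′ < ρ), `mem_nhd_of_mem_Icc`.
* §1 `norm_iteratedDeriv_le_of_holo_nhd`: ‖F^{(m)}(g)‖ ≤ m!·M∕ρ^m at every g ∈ [0, γ₀], every m.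
* §2 the real section: `contDiffAt_re_comp_ofReal` (s ↦ Re F(s) is C^∞ at real points of the neighbourhood), `iteratedDeriv_re_eq`
  (`re` commutes with real iterated derivatives), `iteratedDeriv_re_comp_ofReal` (the m-th REAL derivative of s ↦ Re F(s) is
  Re F^{(m)}), `iteratedDerivWithin_section_eq` (the m-th derivative WITHIN [0, γ₀] of the β-section is Re F^{(m)}(g), γ₀ > 0).
* §3 THE CLAUSE: `contDiffOn_section_of_holo` (every section is C^∞ on [0, γ₀] — «smooth»), `abs_section_le_of_holo` (|β_{k+1}| ≤ M
  on the sections — «uniformly bounded on this interval»), **`abs_iteratedDerivWithin_section_le_of_holo`** (|∂^m β_{k+1}∕∂g_k^m| ≤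
  m!·M∕ρ^m — «together with all derivatives», uniform in k and the history, constants explicit).
* §4 first-order read-out with the sharp radius and the packaged clause: **`p264Clause_of_holo`** (smooth ∧ bounded by M ∧ all
  orders ∧ `LastVarDerivBound β (M∕ρ) γ₀`).
* §5 the converse bookkeeping, hypothesis-free of holomorphy: `lastVarDerivBound_of_derivWithin_bound` (differentiable within
  [0, γ₀] + a uniform bound on the FIRST derivative within ⟹ `LastVarDerivBound`), **`junction_of_p264AllOrders`** (the full clause
  read uniform in j, with any constants C : ℕ → ℝ, enters R-264's chain through its m = 1 line alone: (AF-1) with C 1, hence the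
  JUNCTION shape by (D4-J4) `junction_of_af1`) — every conjunct of print's clause other than the m = 1 line read uniform in j
  is IDLE for (D4): orders m ≥ 2, and the order-0 line «uniformly bounded» even uniform in j (co-owner d4-p2's remark
  R-d4p2-g22-a: (E16)'s family has |β| < r₀ uniformly and every order per j, yet no junction).
* END `allOrders_route_census`.
READING (sense (α)): along R-266 print's whole p. 264 clause is a COROLLARY with constants (m!·M∕ρ^m); along R-264 only its
first-order line is consumed; either way the unprinted datum is the same pair (ρ, M) ∕ the same uniform C, and the INSTANCE
(Bałaban's β with such an extension or such a bound) is 0∕1.  Class UNCHANGED. -/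

noncomputable section

open Metric Set Complex
open scoped Nat

namespace Summit.QuantumFields.BalabanUV.Beta.RemainderCouplingHolomorphyAllOrders

open Literature.MathematicalPhysics.QuantumFieldTheory.Balaban1983to89
open Literature.MathematicalPhysics.QuantumFieldTheory.Balaban1983to89.FlowStep (HBeta)
open Literature.MathematicalPhysics.QuantumFieldTheory.Balaban1983to89.Beta.RemainderChain (RemainderConst)
open Literature.MathematicalPhysics.QuantumFieldTheory.Balaban1983to89.BetaDerivClause
  (LastVarDerivBound lastVarLipschitz_of_derivBound atZero_of_lastVarLipschitz af1_of_atZero)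
open Literature.MathematicalPhysics.QuantumFieldTheory.Balaban1983to89.B12CauchyRemainder354
  (norm_iteratedDeriv_le_of_ball iteratedDeriv_comp_ofReal)
open Summit.QuantumFields.BalabanUV.Beta.RemainderConstTwoShapes (junction_of_af1)
open Summit.QuantumFields.BalabanUV.Beta.RemainderCouplingHolomorphy (hasDerivAt_re_of_holo)

variable {β : HBeta}

/-! ## §0 The uniform ρ-neighbourhood of the coupling interval -/

/-- The ρ-neighbourhood `{z | ∃ s ∈ [0, γ₀], dist z s < ρ}` of the segment is open (a union of open discs). [folklore] -/
theorem isOpen_nhd (γ₀ ρ : ℝ) : IsOpen {z : ℂ | ∃ s : ℝ, s ∈ Icc (0 : ℝ) γ₀ ∧ dist z (s : ℂ) < ρ} := by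
  have : {z : ℂ | ∃ s : ℝ, s ∈ Icc (0 : ℝ) γ₀ ∧ dist z (s : ℂ) < ρ} = ⋃ s ∈ Icc (0 : ℝ) γ₀, ball (s : ℂ) ρ := by
    ext z; simp [mem_ball]
  rw [this]; exact isOpen_biUnion fun _ _ => isOpen_ball

/-- The open disc of radius `ρ` (the FULL radius) about a point of the segment lies in the neighbourhood. [folklore] -/
theorem ball_subset_nhd {γ₀ ρ g : ℝ} (hg : g ∈ Icc (0 : ℝ) γ₀) :
    ball (g : ℂ) ρ ⊆ {z : ℂ | ∃ s : ℝ, s ∈ Icc (0 : ℝ) γ₀ ∧ dist z (s : ℂ) < ρ} :=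
  fun _ hz => ⟨g, hg, mem_ball.mp hz⟩

/-- Real points of the segment lie in the neighbourhood (`ρ > 0`). [folklore] -/
theorem mem_nhd_of_mem_Icc {γ₀ ρ g : ℝ} (hρ : 0 < ρ) (hg : g ∈ Icc (0 : ℝ) γ₀) :
    (g : ℂ) ∈ {z : ℂ | ∃ s : ℝ, s ∈ Icc (0 : ℝ) γ₀ ∧ dist z (s : ℂ) < ρ} :=
  ⟨g, hg, by simpa using hρ⟩

/-! ## §1 Cauchy's estimates of every order on the uniform neighbourhood -/

/-- **Cauchy of order `m` on the uniform neighbourhood, sharp radius.**  If `F` is complex-differentiable on the open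
`ρ`-neighbourhood of `[0, γ₀]` with `‖F‖ ≤ M` there, then `‖F^{(m)}(g)‖ ≤ m!·M∕ρ^m` at every real `g ∈ [0, γ₀]`, for every `m`
(Cauchy on the circles of radius ρ′ ↑ ρ about g, all inside the neighbourhood). [folklore] -/
theorem norm_iteratedDeriv_le_of_holo_nhd {F : ℂ → ℂ} {γ₀ ρ M : ℝ} (hρ : 0 < ρ)
    (hdiff : DifferentiableOn ℂ F {z : ℂ | ∃ s : ℝ, s ∈ Icc (0 : ℝ) γ₀ ∧ dist z (s : ℂ) < ρ})
    (hM : ∀ z : ℂ, (∃ s : ℝ, s ∈ Icc (0 : ℝ) γ₀ ∧ dist z (s : ℂ) < ρ) → ‖F z‖ ≤ M)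
    {g : ℝ} (hg : g ∈ Icc (0 : ℝ) γ₀) (m : ℕ) : ‖iteratedDeriv m F (g : ℂ)‖ ≤ m ! * M / ρ ^ m :=
  norm_iteratedDeriv_le_of_ball hρ (hdiff.mono (ball_subset_nhd hg)) (fun z hz => hM z (ball_subset_nhd hg hz)) m

/-! ## §2 The real section: iterated derivatives within `[0, γ₀]` of `s ↦ Re F(s)` -/

/-- `s ↦ Re F(s)` is `C^n` (any `n`) at a real point `t` with `↑t` in an open set where `F` is holomorphic. [folklore] -/
theorem contDiffAt_re_comp_ofReal {V : Set ℂ} (hV : IsOpen V) {F : ℂ → ℂ} (hF : DifferentiableOn ℂ F V)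
    {t : ℝ} (ht : (t : ℂ) ∈ V) (n : WithTop ℕ∞) : ContDiffAt ℝ n (fun s : ℝ => (F (s : ℂ)).re) t := by
  have hFa : ContDiffAt ℂ n F (t : ℂ) := ((hF.analyticOnNhd hV) _ ht).contDiffAt
  have hG : ContDiffAt ℝ n (fun s : ℝ => F (s : ℂ)) t := by
    have h := (hFa.restrict_scalars ℝ).comp t (Complex.ofRealCLM.contDiff.contDiffAt (x := t))
    simpa [Function.comp_def] using h
  have h2 := (Complex.reCLM.contDiff.contDiffAt (x := F (t : ℂ))).comp t hG
  simpa [Function.comp_def] using h2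

/-- `re` commutes with real iterated derivatives of a `C^m` function `G : ℝ → ℂ`. [folklore] -/
theorem iteratedDeriv_re_eq {G : ℝ → ℂ} {t : ℝ} {m : ℕ} (hG : ContDiffAt ℝ m G t) :
    iteratedDeriv m (fun s : ℝ => (G s).re) t = (iteratedDeriv m G t).re := by
  have hcomp : (fun s : ℝ => (G s).re) = (Complex.reCLM : ℂ →L[ℝ] ℝ) ∘ G := by
    funext s; simp
  rw [iteratedDeriv_eq_iteratedFDeriv, iteratedDeriv_eq_iteratedFDeriv, hcomp,
    Complex.reCLM.iteratedFDeriv_comp_left hG (i := m) le_rfl]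
  simp

/-- **The m-th REAL derivative of the restriction `s ↦ Re F(s)` at a real point of an open set of holomorphy is `Re F^{(m)}`.**
[folklore] -/
theorem iteratedDeriv_re_comp_ofReal {V : Set ℂ} (hV : IsOpen V) {F : ℂ → ℂ} (hF : DifferentiableOn ℂ F V)
    {t : ℝ} (ht : (t : ℂ) ∈ V) (m : ℕ) :
    iteratedDeriv m (fun s : ℝ => (F (s : ℂ)).re) t = (iteratedDeriv m F (t : ℂ)).re := by
  have hG : ContDiffAt ℝ m (fun s : ℝ => F (s : ℂ)) t := by
    have hFa : ContDiffAt ℂ m F (t : ℂ) := ((hF.analyticOnNhd hV) _ ht).contDiffAt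
    have h := (hFa.restrict_scalars ℝ).comp t (Complex.ofRealCLM.contDiff.contDiffAt (x := t))
    simpa [Function.comp_def] using h
  rw [iteratedDeriv_re_eq hG, iteratedDeriv_comp_ofReal hV m hF ht]

/-- **The m-th derivative WITHIN `[0, γ₀]` of the β-section is `Re F^{(m)}(g)`** (`γ₀ > 0`, so `[0, γ₀]` is a set of unique
differentiability; the section agrees with `s ↦ Re F(s)` on the interval, and the latter is smooth at `g`). [folklore] -/
theorem iteratedDerivWithin_section_eq {γ₀ ρ : ℝ} (hγ₀ : 0 < γ₀) (hρ : 0 < ρ) {F : ℂ → ℂ}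
    (hdiff : DifferentiableOn ℂ F {z : ℂ | ∃ s : ℝ, s ∈ Icc (0 : ℝ) γ₀ ∧ dist z (s : ℂ) < ρ})
    {k : ℕ} {p : Fin (k + 1) → ℝ}
    (hF : ∀ g : ℝ, g ∈ Icc (0 : ℝ) γ₀ → F (g : ℂ) = (β k (Function.update p (Fin.last k) g) : ℂ))
    {g : ℝ} (hg : g ∈ Icc (0 : ℝ) γ₀) (m : ℕ) :
    iteratedDerivWithin m (fun s : ℝ => β k (Function.update p (Fin.last k) s)) (Icc (0 : ℝ) γ₀) g
      = (iteratedDeriv m F (g : ℂ)).re := by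
  have heq : EqOn (fun s : ℝ => β k (Function.update p (Fin.last k) s)) (fun s : ℝ => (F (s : ℂ)).re)
      (Icc (0 : ℝ) γ₀) := fun s hs => by
    simp only [hF s hs, Complex.ofReal_re]
  rw [iteratedDerivWithin_congr heq hg,
    iteratedDerivWithin_eq_iteratedDeriv (uniqueDiffOn_Icc hγ₀)
      (contDiffAt_re_comp_ofReal (isOpen_nhd γ₀ ρ) hdiff (mem_nhd_of_mem_Icc hρ hg) m) hg,
    iteratedDeriv_re_comp_ofReal (isOpen_nhd γ₀ ρ) hdiff (mem_nhd_of_mem_Icc hρ hg) m]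

/-! ## §3 The p. 264 clause from uniform coupling-holomorphy: smooth, uniformly bounded, all derivatives -/

section Holo

variable {γ₀ ρ M : ℝ}
  (hHol : ∀ (k : ℕ) (p : Fin (k + 1) → ℝ), p ∈ B12Beta.HistBox γ₀ k → ∃ F : ℂ → ℂ,
    DifferentiableOn ℂ F {z : ℂ | ∃ s : ℝ, s ∈ Icc (0 : ℝ) γ₀ ∧ dist z (s : ℂ) < ρ} ∧
    (∀ z : ℂ, (∃ s : ℝ, s ∈ Icc (0 : ℝ) γ₀ ∧ dist z (s : ℂ) < ρ) → ‖F z‖ ≤ M) ∧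
    ∀ g : ℝ, g ∈ Icc (0 : ℝ) γ₀ → F (g : ℂ) = (β k (Function.update p (Fin.last k) g) : ℂ))
include hHol

/-- **«smooth … on the interval [0, γ]»**: under R-266 every last-variable section is `C^∞` on `[0, γ₀]` (indeed real-analytic),
at every scale and history. [cite: Balaban1987RG1, §1 p.264 — shape only, nothing asserted] -/
theorem contDiffOn_section_of_holo (hρ : 0 < ρ) (k : ℕ) (p : Fin (k + 1) → ℝ) (hp : p ∈ B12Beta.HistBox γ₀ k) :
    ContDiffOn ℝ ⊤ (fun s : ℝ => β k (Function.update p (Fin.last k) s)) (Icc (0 : ℝ) γ₀) := by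
  obtain ⟨F, hdiff, -, hF⟩ := hHol k p hp
  intro g hg
  have heq : ∀ s ∈ Icc (0 : ℝ) γ₀, β k (Function.update p (Fin.last k) s) = (F (s : ℂ)).re := fun s hs => by
    simp only [hF s hs, Complex.ofReal_re]
  exact (contDiffAt_re_comp_ofReal (isOpen_nhd γ₀ ρ) hdiff (mem_nhd_of_mem_Icc hρ hg) ⊤).contDiffWithinAt.congr
    (fun s hs => heq s hs) (heq g hg)

/-- **«uniformly bounded on this interval»**: `|β_{k+1}(g₀,…,g_{k−1}, g)| ≤ M` for `g ∈ [0, γ₀]`, every scale and history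
(the order-zero line; no Cauchy needed). [cite: Balaban1987RG1, §1 p.264 — shape only, nothing asserted] -/
theorem abs_section_le_of_holo (hρ : 0 < ρ) (k : ℕ) (p : Fin (k + 1) → ℝ) (hp : p ∈ B12Beta.HistBox γ₀ k)
    {g : ℝ} (hg : g ∈ Icc (0 : ℝ) γ₀) : |β k (Function.update p (Fin.last k) g)| ≤ M := by
  obtain ⟨F, -, hM, hF⟩ := hHol k p hp
  have h1 : β k (Function.update p (Fin.last k) g) = (F (g : ℂ)).re := by simp only [hF g hg, Complex.ofReal_re]
  rw [h1]
  exact (abs_re_le_norm _).trans (hM _ (mem_nhd_of_mem_Icc hρ hg))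

/-- **«… together with all derivatives», WITH CONSTANTS: `|∂^m β_{k+1}∕∂g_k^m| ≤ m!·M∕ρ^m` on `[0, γ₀]`** (derivative within
the interval), for EVERY order `m`, uniformly in the scale `k` and the history `p` — Cauchy of order `m` on the disc of radius `ρ`
about `g` (§1) and the real-restriction calculus (§2).  For `m = 1` this is R-264's derivative clause with `C = M∕ρ` (§4).
[cite: Balaban1987RG1, §1 p.264 and §2 p.266 — shapes only, nothing asserted] -/
theorem abs_iteratedDerivWithin_section_le_of_holo (hγ₀ : 0 < γ₀) (hρ : 0 < ρ) (m k : ℕ) (p : Fin (k + 1) → ℝ)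
    (hp : p ∈ B12Beta.HistBox γ₀ k) {g : ℝ} (hg : g ∈ Icc (0 : ℝ) γ₀) :
    |iteratedDerivWithin m (fun s : ℝ => β k (Function.update p (Fin.last k) s)) (Icc (0 : ℝ) γ₀) g|
      ≤ m ! * M / ρ ^ m := by
  obtain ⟨F, hdiff, hM, hF⟩ := hHol k p hp
  rw [iteratedDerivWithin_section_eq hγ₀ hρ hdiff hF hg m]
  exact (abs_re_le_norm _).trans (norm_iteratedDeriv_le_of_holo_nhd hρ hdiff hM hg m)

/-! ## §4 The first-order line with the sharp radius, and the clause packaged -/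

/-- **THE p. 264 CLAUSE IN FULL from R-266, read uniform in j, with the Cauchy constants** — for every scale `k` and history
`p ∈ ]0,γ₀]^{k+1}`: (i) the section `g ↦ β_{k+1}(g₀,…,g_{k−1}, g)` is `C^∞` on `[0, γ₀]`; (ii) `|β_{k+1}| ≤ M` there; (iii) for every
`m`, `|∂^m β_{k+1}∕∂g_k^m| ≤ m!·M∕ρ^m` there; and (iv) the first-order line in R-264's currency, `LastVarDerivBound β (M∕ρ) γ₀` — the
SHARP radius ((D4-J5) `lastVarDerivBound_of_holo` gave `M∕ρ′` for `ρ′ < ρ`; the disc of radius ρ about a point of the segment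
lies in the neighbourhood, §0).  SIZE NOTE carried from (D4-J5): `M ≥ |β⁰_{k+1}|`, so none of these constants is b-free.
[cite: Balaban1987RG1, §1 p.264 tl.25–27 and §2 p.266 tl.33–37 — shapes only, nothing asserted] -/
theorem p264Clause_of_holo (hγ₀ : 0 < γ₀) (hρ : 0 < ρ) :
    (∀ (k : ℕ) (p : Fin (k + 1) → ℝ), p ∈ B12Beta.HistBox γ₀ k →
      ContDiffOn ℝ ⊤ (fun s : ℝ => β k (Function.update p (Fin.last k) s)) (Icc (0 : ℝ) γ₀) ∧
      (∀ g : ℝ, g ∈ Icc (0 : ℝ) γ₀ → |β k (Function.update p (Fin.last k) g)| ≤ M) ∧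
      ∀ (m : ℕ) (g : ℝ), g ∈ Icc (0 : ℝ) γ₀ →
        |iteratedDerivWithin m (fun s : ℝ => β k (Function.update p (Fin.last k) s)) (Icc (0 : ℝ) γ₀) g|
          ≤ m ! * M / ρ ^ m) ∧
    LastVarDerivBound β (M / ρ) γ₀ := by
  refine ⟨fun k p hp => ⟨contDiffOn_section_of_holo hHol hρ k p hp,
    fun g hg => abs_section_le_of_holo hHol hρ k p hp hg,
    fun m g hg => abs_iteratedDerivWithin_section_le_of_holo hHol hγ₀ hρ m k p hp hg⟩, fun k p hp => ?_⟩
  obtain ⟨F, hdiff, hM, hF⟩ := hHol k p hp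
  refine ⟨fun g => (deriv F (g : ℂ)).re, fun g hg => ?_, fun g hg => ?_⟩
  · have hder := hasDerivAt_re_of_holo (hdiff.differentiableAt ((isOpen_nhd γ₀ ρ).mem_nhds (mem_nhd_of_mem_Icc hρ hg)))
    have heq : ∀ s ∈ Icc (0 : ℝ) γ₀, (F (s : ℂ)).re = β k (Function.update p (Fin.last k) s) := fun s hs => by
      rw [hF s hs, Complex.ofReal_re]
    exact hder.hasDerivWithinAt.congr (fun s hs => (heq s hs).symm) (heq g hg).symm
  · have h1 := norm_iteratedDeriv_le_of_holo_nhd hρ hdiff hM hg 1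
    rw [iteratedDeriv_one, Nat.factorial_one, Nat.cast_one, one_mul, pow_one] at h1
    exact (abs_re_le_norm _).trans h1

end Holo

/-! ## §5 The converse bookkeeping: the full clause enters R-264's chain through its first-order line alone -/

/-- **Differentiable within `[0, γ₀]` + ONE bound on the first derivative within, uniform in scale and history ⟹
`LastVarDerivBound β C γ₀`** (the derivative function is `derivWithin`). [folklore] -/
theorem lastVarDerivBound_of_derivWithin_bound {γ₀ C : ℝ}
    (hdiff : ∀ (k : ℕ) (p : Fin (k + 1) → ℝ), p ∈ B12Beta.HistBox γ₀ k →
      DifferentiableOn ℝ (fun s : ℝ => β k (Function.update p (Fin.last k) s)) (Icc (0 : ℝ) γ₀))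
    (hbound : ∀ (k : ℕ) (p : Fin (k + 1) → ℝ), p ∈ B12Beta.HistBox γ₀ k → ∀ g : ℝ, g ∈ Icc (0 : ℝ) γ₀ →
      |iteratedDerivWithin 1 (fun s : ℝ => β k (Function.update p (Fin.last k) s)) (Icc (0 : ℝ) γ₀) g| ≤ C) :
    LastVarDerivBound β C γ₀ := by
  intro k p hp
  refine ⟨derivWithin (fun s : ℝ => β k (Function.update p (Fin.last k) s)) (Icc (0 : ℝ) γ₀),
    fun g hg => ((hdiff k p hp) g hg).hasDerivWithinAt, fun g hg => ?_⟩
  simpa only [iteratedDerivWithin_one] using hbound k p hp g hg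

/-- **THE FULL p. 264 CLAUSE (read uniform in j, any constants `C : ℕ → ℝ`) ⟹ THE JUNCTION SHAPE OF (D4) — through its m = 1
line alone.**  If every section is `C^∞` on `[0, γ₀]` and `|∂^m β_{k+1}∕∂g_k^m| ≤ C m` there for all `m`, uniformly in scale and
history, then `LastVarDerivBound β (C 1) γ₀`, hence (AF-1) with constant `C 1` for the printed split (`BetaDerivClause` chain),
hence the junction ((D4-J4) `junction_of_af1`).  The orders `m ≥ 2` of print's clause, and its order-0 line «uniformly
bounded» even read uniform in j, are IDLE for (D4) (two-sided by (E16) `EriceRemainderEnclosureHolomorphyNecessity`: its entire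
family is bounded by r₀ uniformly in j with every derivative bounded per j, and has no junction — remark R-d4p2-g22-a).
[cite: Balaban1987RG1, §1 p.264 tl.25–27 and (2.12)–(2.14) p.268 — shapes only, nothing asserted] -/
theorem junction_of_p264AllOrders (S : B12Beta.OneLoopSplit β) {γ₀ : ℝ} (hγ₀ : 0 < γ₀) {C : ℕ → ℝ}
    (hClause : ∀ (k : ℕ) (p : Fin (k + 1) → ℝ), p ∈ B12Beta.HistBox γ₀ k →
      ContDiffOn ℝ ⊤ (fun s : ℝ => β k (Function.update p (Fin.last k) s)) (Icc (0 : ℝ) γ₀) ∧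
      ∀ (m : ℕ) (g : ℝ), g ∈ Icc (0 : ℝ) γ₀ →
        |iteratedDerivWithin m (fun s : ℝ => β k (Function.update p (Fin.last k) s)) (Icc (0 : ℝ) γ₀) g| ≤ C m) :
    LastVarDerivBound β (C 1) γ₀ ∧
    (∀ (k : ℕ) (p : Fin (k + 1) → ℝ), p ∈ B12Beta.HistBox γ₀ k → |S.β1 k p| ≤ C 1 * p (Fin.last k)) ∧
    ∀ b : ℝ, 0 < b → ∃ γ₁ : ℝ, 0 < γ₁ ∧ ∀ γ : ℝ, 0 < γ → γ ≤ γ₁ →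
      ∃ r : ℝ, 0 ≤ r ∧ r < b ∧ RemainderConst S γ r := by
  have hD : LastVarDerivBound β (C 1) γ₀ :=
    lastVarDerivBound_of_derivWithin_bound
      (fun k p hp => ((hClause k p hp).1.differentiableOn (by simp)))
      (fun k p hp g hg => (hClause k p hp).2 1 g hg)
  have hAF1 := af1_of_atZero S (atZero_of_lastVarLipschitz (lastVarLipschitz_of_derivBound hD))
  have hC : 0 ≤ C 1 := by
    obtain ⟨f', -, hb⟩ := hD 0 (fun _ => γ₀) (fun _ => ⟨hγ₀, le_rfl⟩)
    exact (abs_nonneg _).trans (hb 0 ⟨le_rfl, hγ₀.le⟩)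
  exact ⟨hD, hAF1, junction_of_af1 S hC hγ₀ hAF1⟩

/-! ## END -/

/-- **END — THE ALL-ORDERS ROUTE CENSUS for row D4's regularity clause.**  (a) R-266 (uniform (ρ, M) coupling-holomorphy,
(D4-J5)'s hypothesis verbatim) ⟹ print's p. 264 clause IN FULL, read uniform in j, with constants: C^∞ sections, |β_{k+1}| ≤ M,
|∂^m β_{k+1}∕∂g_k^m| ≤ m!·M∕ρ^m for every m, and `LastVarDerivBound β (M∕ρ) γ₀`; (b) the full clause with ANY constants
`C : ℕ → ℝ` ⟹ `LastVarDerivBound β (C 1) γ₀` ⟹ (AF-1) ⟹ the JUNCTION shape — so print's two wordings («analytic» p. 266 ∕ «all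
derivatives uniformly bounded» p. 264) meet R-264's chain at the SAME first-order line, and what either needs beyond print is the
same uniformity datum ((ρ, M), resp. C 1), necessary by (E16) ∕ (D4-J4)'s witnesses; instance 0∕1.
[cite: Balaban1987RG1, §1 p.264 tl.25–27 and §2 p.266 tl.33–37 — shapes only, nothing asserted] -/
theorem allOrders_route_census (S : B12Beta.OneLoopSplit β) {γ₀ : ℝ} (hγ₀ : 0 < γ₀) :
    (∀ (ρ M : ℝ), 0 < ρ →
      (∀ (k : ℕ) (p : Fin (k + 1) → ℝ), p ∈ B12Beta.HistBox γ₀ k → ∃ F : ℂ → ℂ,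
        DifferentiableOn ℂ F {z : ℂ | ∃ s : ℝ, s ∈ Icc (0 : ℝ) γ₀ ∧ dist z (s : ℂ) < ρ} ∧
        (∀ z : ℂ, (∃ s : ℝ, s ∈ Icc (0 : ℝ) γ₀ ∧ dist z (s : ℂ) < ρ) → ‖F z‖ ≤ M) ∧
        ∀ g : ℝ, g ∈ Icc (0 : ℝ) γ₀ → F (g : ℂ) = (β k (Function.update p (Fin.last k) g) : ℂ)) →
      (∀ (k : ℕ) (p : Fin (k + 1) → ℝ), p ∈ B12Beta.HistBox γ₀ k →
        ContDiffOn ℝ ⊤ (fun s : ℝ => β k (Function.update p (Fin.last k) s)) (Icc (0 : ℝ) γ₀) ∧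
        (∀ g : ℝ, g ∈ Icc (0 : ℝ) γ₀ → |β k (Function.update p (Fin.last k) g)| ≤ M) ∧
        ∀ (m : ℕ) (g : ℝ), g ∈ Icc (0 : ℝ) γ₀ →
          |iteratedDerivWithin m (fun s : ℝ => β k (Function.update p (Fin.last k) s)) (Icc (0 : ℝ) γ₀) g|
            ≤ m ! * M / ρ ^ m) ∧
      LastVarDerivBound β (M / ρ) γ₀) ∧
    (∀ C : ℕ → ℝ,
      (∀ (k : ℕ) (p : Fin (k + 1) → ℝ), p ∈ B12Beta.HistBox γ₀ k →
        ContDiffOn ℝ ⊤ (fun s : ℝ => β k (Function.update p (Fin.last k) s)) (Icc (0 : ℝ) γ₀) ∧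
        ∀ (m : ℕ) (g : ℝ), g ∈ Icc (0 : ℝ) γ₀ →
          |iteratedDerivWithin m (fun s : ℝ => β k (Function.update p (Fin.last k) s)) (Icc (0 : ℝ) γ₀) g| ≤ C m) →
      LastVarDerivBound β (C 1) γ₀ ∧
      (∀ (k : ℕ) (p : Fin (k + 1) → ℝ), p ∈ B12Beta.HistBox γ₀ k → |S.β1 k p| ≤ C 1 * p (Fin.last k)) ∧
      ∀ b : ℝ, 0 < b → ∃ γ₁ : ℝ, 0 < γ₁ ∧ ∀ γ : ℝ, 0 < γ → γ ≤ γ₁ →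
        ∃ r : ℝ, 0 ≤ r ∧ r < b ∧ RemainderConst S γ r) :=
  ⟨fun _ _ hρ hHol => p264Clause_of_holo hHol hγ₀ hρ, fun _ hClause => junction_of_p264AllOrders S hγ₀ hClause⟩

end Summit.QuantumFields.BalabanUV.Beta.RemainderCouplingHolomorphyAllOrders

end
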